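import Summits.PneNP.PneNP.Theorems.PseudorandomTwinsAbove.Negative.FalseWithoutPolyTime
import Literature.Computability.Complexity.Transducers
import Literature.Computability.Complexity.PairProjections
import Literature.Computability.Complexity.RandomizedProofs
import Literature.Computability.Complexity.TimeBoundsProofs

/-!
# Route PhaseTwins, crux `PseudorandomTwinsAbove` (stmt-PneNP-2721) — negative side: regular tests

Companion of `Negative/FalseWithoutPolyTime.lean` (crux stmt-PneNP-2721,
`Summit.PneNP.PneNP.Theses.PhaseTwins.PseudorandomTwinsAbove`), from the disprover's work file
`Summits/PneNP/PneNP/Cruxes/PseudorandomTwinsAbove/Disproof.lean` (cycle 2). Continued in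
`Negative/EscapeAndJunk.lean`.

The typed test class of clause (i) (`A : RandAlg (List Bool) Bool`, `A.IsPolyTime id encodeBool`,
acceptance `A.pr id x {true}`, free coin budget `coinLen`) provably CONTAINS:

* every REGULAR test `x ↦ [x ∈ L(M)]`, `M` a DFA with finitely many states
  (`isPolyTime_ofDet_dfa`, via the finite-state-transducer machine `FST.polyTimeComputable_eval`);
  in particular every finite-set indicator (`exists_dfa_of_finite`, Myhill–Nerode);
* every LENGTH-SET test `x ↦ [|x| ∈ T]` for an ARBITRARY `T ⊆ ℕ` (`isPolyTime_coinFlag`,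
  `pr_coinFlag`): the coin budget `coinLen |x| := [|x| ∈ T]` is admissible advice and the machine
  only reports whether it received a coin.

Consequences of clause (i) ALONE for every witness `(D₀, D₁)`:

* `dfa_merge`, `finite_merge`, `lengthSet_merge`: the two ensembles give asymptotically equal mass
  to every regular language, every finite set, and every set of lengths;
* `no_twins_on_disjoint_lengthSets`, `no_twins_at_distinct_lengths`: the length laws of `D₀ n`,
  `D₁ n` cannot concentrate on disjoint sets of lengths (gliding hump on `ℕ`,
  `no_setwise_indistinguishable_far_pair`) — YES- and NO-instances of a witness must share their
  lengths; padding the two sides differently is fatal.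
-/
namespace Summit.PneNP.PneNP.Theorems.PseudorandomTwinsAbove.Negative

open Literature.Computability.Complexity Literature.Computability.MetaComplexity
open Filter Topology
open scoped ENNReal

noncomputable section

/-! ## The test class contains every regular test -/

/-- DFA acceptance `x ↦ [M accepts x]` is polynomial-time computable (output one bit,
`encodeBool`): run the DFA as a finite-state transducer that emits nothing and prepends the
acceptance bit of its final state (`FST.polyTimeComputable_eval`). [folklore] -/
theorem polyTimeComputable_dfa {σ : Type} [Fintype σ] (M : DFA Bool σ)
    [DecidablePred (· ∈ M.accept)] :
    PolyTimeComputable (id : List Bool → List Bool) Computability.encodeBool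
      (fun x => decide (M.eval x ∈ M.accept)) := by
  let T : FST σ Bool Bool :=
    { init := M.start
      step := fun s a => (M.step s a, [])
      front := fun s => [decide (s ∈ M.accept)]
      keep := fun _ => false }
  have hrun : ∀ (x : List Bool) (s : σ), (T.run s x).1 = M.evalFrom s x := by
    intro x
    induction x with
    | nil => intro s; rfl
    | cons a x ih => intro s; exact ih (M.step s a)
  have heval : ∀ x, T.eval x = [decide (M.eval x ∈ M.accept)] := by
    intro x
    have h1 : T.eval x = [decide ((T.run M.start x).1 ∈ M.accept)] := rfl
    rw [h1, hrun]
    rfl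
  exact PolyTimeComputable.of_encode_eq (f := T.eval) (ea := id) (eb := id) id (fun _ => rfl)
    (fun x => by rw [heval]; rfl) T.polyTimeComputable_eval

/-- Hence the deterministic regular test `1_{L(M)}` is a PPT test of clause (i)
(`RandAlg.IsPolyTime.ofDet_holds`). [folklore] -/
theorem isPolyTime_ofDet_dfa {σ : Type} [Fintype σ] (M : DFA Bool σ)
    [DecidablePred (· ∈ M.accept)] :
    (RandAlg.ofDet fun x => decide (M.eval x ∈ M.accept)).IsPolyTime
      (id : List Bool → List Bool) Computability.encodeBool :=
  RandAlg.IsPolyTime.ofDet_holds (polyTimeComputable_dfa M)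

/-- Every finite set of strings is recognised by a finite DFA (Myhill–Nerode: the left
quotients of a finite language are subsets of its finite set of suffixes). [folklore] -/
theorem exists_dfa_of_finite {S : Set (List Bool)} (hS : S.Finite) :
    ∃ (σ : Type) (_ : Fintype σ) (M : DFA Bool σ), ∀ x, M.eval x ∈ M.accept ↔ x ∈ S := by
  let L : Language Bool := S
  have hsuff : {y : List Bool | ∃ w ∈ S, y <:+ w}.Finite := by
    have heq : {y : List Bool | ∃ w ∈ S, y <:+ w} = ⋃ w ∈ S, {y | y <:+ w} := by
      ext y; simp
    rw [heq]
    exact hS.biUnion fun w _ =>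
      (List.finite_toSet w.tails).subset fun y (hy : y <:+ w) => (List.mem_tails _ _).2 hy
  have hrange : (Set.range L.leftQuotient).Finite := by
    refine (hsuff.finite_subsets).subset ?_
    rintro _ ⟨x, rfl⟩ y (hy : x ++ y ∈ S)
    exact ⟨x ++ y, hy, List.suffix_append x y⟩
  obtain ⟨σ, hσ, M, hM⟩ := Language.IsRegular.of_finite_range_leftQuotient hrange
  refine ⟨σ, hσ, M, fun x => ?_⟩
  change x ∈ M.accepts ↔ x ∈ L
  rw [hM]

/-- Finite-set indicators are polynomial-time tests. [folklore] -/
theorem exists_polyTime_test_of_finite {S : Set (List Bool)} (hS : S.Finite)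
    [DecidablePred (· ∈ S)] :
    (RandAlg.ofDet fun x => decide (x ∈ S)).IsPolyTime
      (id : List Bool → List Bool) Computability.encodeBool := by
  obtain ⟨σ, hσ, M, hM⟩ := exists_dfa_of_finite hS
  classical
  have h := isPolyTime_ofDet_dfa M
  have hfun : (fun x => decide (M.eval x ∈ M.accept)) = fun x => decide (x ∈ S) :=
    funext fun x => decide_eq_decide.2 (hM x)
  rw [hfun] at h
  exact h

/-! ## The test class contains every length-set test (coin-length advice) -/

/-- A randomized algorithm whose output does not depend on the coins (of the prescribed length)
has a Dirac output law. [folklore] -/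
theorem pr_eq_of_forall_run {α β : Type} (A : RandAlg α β) (ea : α → List Bool) (x : α) (b : β)
    (h : ∀ r : List Bool, r.length = A.coinLen (ea x).length → A.run x r = b) (E : Set β)
    [Decidable (b ∈ E)] : A.pr ea x E = if b ∈ E then 1 else 0 := by
  have hf : (fun r : List.Vector Bool (A.coinLen (ea x).length) => A.run x r.toList) =
      fun _ => b :=
    funext fun r => h r.toList r.toList_length
  have hmap : A.outputPMF ea x = PMF.pure b := by
    unfold RandAlg.outputPMF
    rw [hf]
    exact PMF.map_const _ _
  rw [RandAlg.pr, hmap, PMF.toOuterMeasure_pure_apply]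
  split_ifs <;> simp

/-- THE COIN-FLAG MACHINE IS PPT FOR EVERY POLYNOMIALLY BOUNDED COIN BUDGET. It ignores `x` and
reports whether its coin string is non-empty: the second pair projection
(`polyTimeComputable_snd_holds`) followed by a two-state DFA, composed by
`PolyTimeComputable.comp_holds`. Since `RandAlg.IsPolyTime` constrains `coinLen` only by a
polynomial bound, `coinLen` may be ANY `{0,1}`-valued function of the input length. [folklore] -/
theorem isPolyTime_coinFlag (c : ℕ → ℕ) (pc : Polynomial ℕ) (hc : ∀ n, c n ≤ pc.eval n) :
    ({ run := fun _ r => !r.isEmpty, coinLen := c } : RandAlg (List Bool) Bool).IsPolyTime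
      (id : List Bool → List Bool) Computability.encodeBool := by
  refine ⟨?_, pc, hc⟩
  have hsnd : PolyTimeComputable (fun p : List Bool × List Bool => boolPair (id p.1) p.2)
      (id : List Bool → List Bool) (Prod.snd : List Bool × List Bool → List Bool) :=
    PolyTimeComputable.of_encode_eq (f := (Prod.snd : List Bool × List Bool → List Bool)) id
      (fun _ => rfl) (fun _ => rfl) polyTimeComputable_snd_holds
  -- the two-state DFA "some symbol was read"
  let M : DFA Bool Bool := ⟨fun _ _ => true, false, {b | b = true}⟩
  have hfold : ∀ (r : List Bool) (s : Bool), M.evalFrom s r = (s || !r.isEmpty) := by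
    intro r
    induction r with
    | nil => intro s; simp
    | cons a r ih =>
      intro s
      rw [DFA.evalFrom_cons, ih]
      simp [M]
  have hbit : ∀ r : List Bool, decide (M.eval r ∈ M.accept) = !r.isEmpty := by
    intro r
    have h1 : M.eval r = M.evalFrom false r := rfl
    rw [h1, hfold]
    cases r <;> simp [M]
  have hne : PolyTimeComputable (id : List Bool → List Bool) Computability.encodeBool
      (fun r : List Bool => !r.isEmpty) :=
    PolyTimeComputable.of_encode_eq (f := fun r => decide (M.eval r ∈ M.accept)) (ea := id)
      (eb := Computability.encodeBool) id (fun _ => rfl)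
      (fun r => congrArg Computability.encodeBool (hbit r)) (polyTimeComputable_dfa M)
  exact PolyTimeComputable.comp_holds hne hsnd

/-- Acceptance probability of the coin-flag machine: `1` if it receives a coin, `0` if not.
[folklore] -/
theorem pr_coinFlag (c : ℕ → ℕ) (x : List Bool) :
    ({ run := fun _ r => !r.isEmpty, coinLen := c } : RandAlg (List Bool) Bool).pr id x
      {b | b = true} = if 0 < c x.length then 1 else 0 := by
  rw [pr_eq_of_forall_run _ id x (decide (0 < c x.length)) ?_ {b | b = true}]
  · by_cases h : 0 < c x.length <;> simp [h]
  · intro r hr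
    change (!r.isEmpty) = decide (0 < c x.length)
    change r.length = c x.length at hr
    cases r with
    | nil => simp at hr; simp [← hr]
    | cons a r => simp at hr ⊢; omega

/-! ## Acceptance functionals are masses -/

/-- If a test accepts `x` with probability `1_S(x)`, its acceptance functional against `D` is
`D(S)`. [folklore] -/
theorem tsum_mul_indicator_eq_mass (D : PMF (List Bool)) (S : Set (List Bool))
    [DecidablePred (· ∈ S)] (a : List Bool → ℝ) (ha : ∀ x, a x = if x ∈ S then 1 else 0) :
    ∑' x, (D x).toReal * a x = (PMF.toOuterMeasure D S).toReal := by
  classical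
  simp_rw [ha]
  rw [PMF.toOuterMeasure_apply, ENNReal.tsum_toReal_eq (fun x => ?_)]
  · refine tsum_congr fun x => ?_
    by_cases hx : x ∈ S
    · simp [hx]
    · simp [hx]
  · exact ((Set.indicator_le_self S D x).trans_lt (PMF.apply_lt_top D x)).ne

/-- Acceptance functional of a DFA test = mass of its language. [folklore] -/
theorem tsum_dfaTest_eq_mass (D : PMF (List Bool)) {σ : Type} (M : DFA Bool σ)
    [DecidablePred (· ∈ M.accept)] :
    ∑' x, (D x).toReal * (RandAlg.ofDet fun x => decide (M.eval x ∈ M.accept)).pr id x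
      {b | b = true} = (PMF.toOuterMeasure D {x | M.eval x ∈ M.accept}).toReal := by
  classical
  refine tsum_mul_indicator_eq_mass D {x | M.eval x ∈ M.accept} _ fun x => ?_
  rw [RandAlg.pr_ofDet]
  by_cases hx : M.eval x ∈ M.accept <;> simp [hx]

/-- Acceptance functional of the coin-flag test with budget `1_T` = mass of `{x : |x| ∈ T}`.
[folklore] -/
theorem tsum_coinFlag_eq_mass (D : PMF (List Bool)) (T : Set ℕ) [DecidablePred (· ∈ T)] :
    ∑' x, (D x).toReal *
      ({ run := fun _ r => !r.isEmpty, coinLen := fun ℓ => if ℓ ∈ T then 1 else 0 } :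
        RandAlg (List Bool) Bool).pr id x {b | b = true}
      = (PMF.toOuterMeasure D {x | x.length ∈ T}).toReal := by
  classical
  refine tsum_mul_indicator_eq_mass D {x | x.length ∈ T} _ fun x => ?_
  rw [pr_coinFlag]
  by_cases hx : x.length ∈ T <;> simp [hx]

/-! ## Consequences of clause (i): regular languages and length sets merge -/

/-- CLAUSE (i) FORCES EQUAL ASYMPTOTIC MASS ON EVERY REGULAR LANGUAGE. [this work] -/
theorem dfa_merge (D₀ D₁ : Ensemble)
    (hind : ∀ A : RandAlg (List Bool) Bool,
      A.IsPolyTime (id : List Bool → List Bool) Computability.encodeBool →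
      Tendsto (fun n : ℕ => |(∑' x : List Bool, ((D₀ n) x).toReal * A.pr id x {b | b = true}) -
        (∑' x : List Bool, ((D₁ n) x).toReal * A.pr id x {b | b = true})|) atTop (𝓝 0))
    {σ : Type} [Fintype σ] (M : DFA Bool σ) :
    Tendsto (fun n => |D₀.prob n {x | M.eval x ∈ M.accept} - D₁.prob n {x | M.eval x ∈ M.accept}|)
      atTop (𝓝 0) := by
  classical
  have h := hind _ (isPolyTime_ofDet_dfa M)
  simp only [tsum_dfaTest_eq_mass] at h
  exact h

/-- CLAUSE (i) FORCES EQUAL ASYMPTOTIC MASS ON EVERY FINITE SET. [this work] -/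
theorem finite_merge (D₀ D₁ : Ensemble)
    (hind : ∀ A : RandAlg (List Bool) Bool,
      A.IsPolyTime (id : List Bool → List Bool) Computability.encodeBool →
      Tendsto (fun n : ℕ => |(∑' x : List Bool, ((D₀ n) x).toReal * A.pr id x {b | b = true}) -
        (∑' x : List Bool, ((D₁ n) x).toReal * A.pr id x {b | b = true})|) atTop (𝓝 0))
    {S : Set (List Bool)} (hS : S.Finite) :
    Tendsto (fun n => |D₀.prob n S - D₁.prob n S|) atTop (𝓝 0) := by
  obtain ⟨σ, hσ, M, hM⟩ := exists_dfa_of_finite hS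
  have hset : {x | M.eval x ∈ M.accept} = S := Set.ext hM
  have h := dfa_merge D₀ D₁ hind M
  rw [hset] at h
  exact h

/-- CLAUSE (i) FORCES THE LENGTH LAWS TO MERGE SETWISE: for every `T ⊆ ℕ` (computable or not)
`|D₀ n (|x| ∈ T) − D₁ n (|x| ∈ T)| → 0` — the coin-length advice reads `[|x| ∈ T]`. [this work] -/
theorem lengthSet_merge (D₀ D₁ : Ensemble)
    (hind : ∀ A : RandAlg (List Bool) Bool,
      A.IsPolyTime (id : List Bool → List Bool) Computability.encodeBool →
      Tendsto (fun n : ℕ => |(∑' x : List Bool, ((D₀ n) x).toReal * A.pr id x {b | b = true}) -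
        (∑' x : List Bool, ((D₁ n) x).toReal * A.pr id x {b | b = true})|) atTop (𝓝 0))
    (T : Set ℕ) :
    Tendsto (fun n => |D₀.prob n {x | x.length ∈ T} - D₁.prob n {x | x.length ∈ T}|)
      atTop (𝓝 0) := by
  classical
  have hA := isPolyTime_coinFlag (fun ℓ => if ℓ ∈ T then 1 else 0) 1
    (fun n => by split_ifs <;> simp)
  have h := hind _ hA
  simp only [tsum_coinFlag_eq_mass] at h
  exact h

/-- NO TWINS ON DISJOINT LENGTH SETS. If the lengths of `D₀ n`-samples concentrate on `T₀ n` and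
those of `D₁ n`-samples on `T₁ n` with `T₀ n ∩ T₁ n = ∅`, clause (i) fails: by `lengthSet_merge`
the length laws (push-forwards to `ℕ`) would be setwise indistinguishable while concentrating on
disjoint events, which the gliding hump `no_setwise_indistinguishable_far_pair` forbids. So a
witness cannot pad YES- and NO-instances to different lengths, use codes of different sizes on
the two sides, etc. [this work] -/
theorem no_twins_on_disjoint_lengthSets (D₀ D₁ : Ensemble)
    (hind : ∀ A : RandAlg (List Bool) Bool,
      A.IsPolyTime (id : List Bool → List Bool) Computability.encodeBool →
      Tendsto (fun n : ℕ => |(∑' x : List Bool, ((D₀ n) x).toReal * A.pr id x {b | b = true}) -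
        (∑' x : List Bool, ((D₁ n) x).toReal * A.pr id x {b | b = true})|) atTop (𝓝 0))
    (T₀ T₁ : ℕ → Set ℕ) (hT : ∀ n, Disjoint (T₀ n) (T₁ n))
    (h₀ : Tendsto (fun n => D₀.prob n {x | x.length ∈ T₀ n}) atTop (𝓝 1))
    (h₁ : Tendsto (fun n => D₁.prob n {x | x.length ∈ T₁ n}) atTop (𝓝 1)) : False := by
  have hmap : ∀ (D : PMF (List Bool)) (S : Set ℕ),
      (PMF.toOuterMeasure (D.map List.length) S).toReal =
        (PMF.toOuterMeasure D {x | x.length ∈ S}).toReal := by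
    intro D S
    rw [PMF.toOuterMeasure_map_apply]
    rfl
  refine no_setwise_indistinguishable_far_pair (fun n => (D₀ n).map List.length)
    (fun n => (D₁ n).map List.length) T₀ T₁ hT ?_ ?_ ?_
  · simp only [hmap]; exact h₀
  · simp only [hmap]; exact h₁
  · intro S
    simp only [hmap]
    exact lengthSet_merge D₀ D₁ hind S

/-- REFUTED VARIANT (corollary): twins living at DIFFERENT LENGTHS `ℓ₀ n ≠ ℓ₁ n` do not exist,
whatever the functions `ℓ₀, ℓ₁` (computable or not) — the test class sees `[|x| ∈ T]` for every
`T ⊆ ℕ`. [this work] -/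
theorem no_twins_at_distinct_lengths (D₀ D₁ : Ensemble)
    (hind : ∀ A : RandAlg (List Bool) Bool,
      A.IsPolyTime (id : List Bool → List Bool) Computability.encodeBool →
      Tendsto (fun n : ℕ => |(∑' x : List Bool, ((D₀ n) x).toReal * A.pr id x {b | b = true}) -
        (∑' x : List Bool, ((D₁ n) x).toReal * A.pr id x {b | b = true})|) atTop (𝓝 0))
    (ℓ₀ ℓ₁ : ℕ → ℕ) (hne : ∀ n, ℓ₀ n ≠ ℓ₁ n)
    (h₀ : Tendsto (fun n => D₀.prob n {x | x.length = ℓ₀ n}) atTop (𝓝 1))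
    (h₁ : Tendsto (fun n => D₁.prob n {x | x.length = ℓ₁ n}) atTop (𝓝 1)) : False :=
  no_twins_on_disjoint_lengthSets D₀ D₁ hind (fun n => {ℓ₀ n}) (fun n => {ℓ₁ n})
    (fun n => Set.disjoint_singleton.2 (hne n)) (by simpa using h₀) (by simpa using h₁)

end

end Summit.PneNP.PneNP.Theorems.PseudorandomTwinsAbove.Negative
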